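import Literature.AlgebraicGeometry.Frobenioids.ArchimedeanRCIsoSubanchorR
import Literature.AlgebraicGeometry.Frobenioids.ArchimedeanQuasiIsotropic
import Literature.AlgebraicGeometry.Frobenioids.ArchimedeanNotIsoSubanchor
import Literature.AlgebraicGeometry.Frobenioids.ArchimedeanIsometries
import Literature.AlgebraicGeometry.Frobenioids.ArchimedeanPointBaseThm36
import Literature.AlgebraicGeometry.Frobenioids.PadicFrobenioidQpSplit
import HarnessLib

/-!
# Frobenioids II, §3 at THE archimedean Frobenioid `C_v` of [IUTchI] Example 3.4 (i): the one-morphism base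
# `Spec ℂ` is of RC-standard type, and Proposition 3.5 (ii), (iii) [for `R`], (iv) and the «standard type»
# conjuncts of Theorem 3.6 (i), (ii) hold there with NO hypothesis left

Mochizuki, *The geometry of Frobenioids II: poly-Frobenioids*, Kyushu J. Math. **62** (2008) 401–460, §3,
Definition 3.1 (v) p. 25 («RC-standard type»), Proposition 3.5 (i)–(iv) p. 34, Theorem 3.6 (i)(ii) pp. 36–37
[cite: MochizukiFrdII2008, Prop 3.5 p.34], at the data of *Inter-universal Teichmüller theory I*, Example 3.4 (i),
kurims text (May 2020) p. 80: "`C_v` … the archimedean Frobenioid as in [FrdII], Example 3.3, (ii), where we take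
the base category to be the one-morphism category determined by `Spec(K_v)`" [cite: Mochizuki2012, Ex 3.4 (i) p.80]
— i.e. the base functor `ArchFrd.ptBase : Discrete PUnit ⥤ D₀` (value `Spec ℂ`) of `ArchimedeanPointBase.lean`
(abc-iut-L1-t6) and `C_v = ArchFrd.Cpt = C ptBase`.

PROOF-ONLY file (abc-iut cell, layer L1; the Prop. 3.5 / Def. 3.1 (v) sibling of abc-iut-w4-d074's
`ArchimedeanPointBaseThm36(B).lean`; seat abc-iut-w4-d027 gen 3, holder of node `FrdII:Prop3.5(iii)`, following the
second reader abc-iut-w5-d146's note that the §3 standing hypotheses should be discharged at the IUT archimedean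
base). Contents, everything PROVED, nothing (re)defined:

* **the one-morphism base is of RC-standard type** ([FrdII] Def. 3.1 (v) (a)–(d) + «totally epimorphic»):
  `isRCAnchor_discretePUnit` (the point is its own RC-anchor: no irreducible arrow leaves it),
  `ptBase_isOfRCIsoSubanchorType` (trivial group, identity quotient — [FrdI] §0 «an isomorphism is always a
  mono-minimal categorical quotient of its domain by the trivial group»,
  `IsTotallyEpimorphic.isMonoMinimalQuotient_bot_of_isIso`), `ptBase_isRCConnected`, `isOfFSMFFType_discretePUnit`
  (abc-iut-L1-t4's `PadicFrd.isOfFSMType_discretePUnit`), **`ptBase_isOfRCStandardType`** (complexifiable: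
  abc-iut-w4-d074's `Thm36Sub.ptBase_isComplexifiable`) — the standing hypothesis on `D` of Prop. 3.5 / Thm. 3.6;
* hence, HYPOTHESIS-FREE at `C_v`, `A_v`, `R_v`: Prop. 3.5 (ii) (`prop35ii_C_ptBase`, `prop35ii_A_ptBase`:
  abc-iut-w4-d092's `prop35ii_C/_A`; unconditional readings `Cpt/Apt.not_isIsotropic_iff_isIsoSubanchor`),
  Prop. 3.5 (iii) for `R` (`R.isOfRCIsoSubanchorType_ptBase`: gen 2's `prop35iii_R_holds` with its antecedent
  discharged), Prop. 3.5 (iv) (`prop35iv_C_ptBase`, `prop35iv_A_ptBase`, `Cpt/Apt.not_isOfRCIsoSubanchorType`: gen 0's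
  `prop35iv_C/_A_of_isFrobenioid` with `Cpt.isFrobenioid` and `Apt.isFrobenioid` = [FrdII] Ex. 3.3 (iii) at the
  point), and the «standard type» conjuncts of Thm. 3.6 (i) for `C_v` and Thm. 3.6 (ii) for `A_v`
  (`Cpt.isOfStandardType`, `Apt.isOfStandardType`: abc-iut-w4-d092's `C/A.isOfStandardType` with all four base
  hypotheses discharged).

Prop. 3.5 (i) at `ptBase` is abc-iut-w4-d100's `prop35i_all_ptBase` (`ArchimedeanProp35iArithmeticBases.lean`) and
Prop. 3.5 (iii) for `N` at `ptBase` is the companion `ArchimedeanPointBaseProp35N.lean` (it needs the olean of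
`ArchimedeanAngloidAnchorsN.lean`); neither is restated here. No definitions; no statement of the paper is
strengthened or re-typed; nothing here bears on [IUTchIII] Cor. 3.12 (the content is the classical, refereed
[FrdII] §3). typed ≠ proved except where a `theorem` says so.
-/

namespace Literature.AlgebraicGeometry.Frobenioids

open CategoryTheory

noncomputable section

namespace ArchFrd


/-! ### The one-morphism base `Spec ℂ` of [IUTchI] Example 3.4 (i) is of RC-standard type -/

/-- Every object of the one-morphism base over `Spec ℂ` is an **RC-anchor**: it is complex, and no irreducible
arrow of `D[ℂ] = D` leaves it (every arrow of the one-morphism category is an isomorphism), so the set of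
isomorphism classes to be finite ([FrdI] §0 «anchor») is empty. [cite: MochizukiFrdII2008, Def 3.1 (v) p.25] -/
theorem isRCAnchor_discretePUnit (X : Discrete PUnit.{1}) : RC.IsRCAnchor (baseRC ptBase) X := by
  refine ⟨D0.isComplex_specComplex, Set.Finite.subset Set.finite_empty ?_⟩
  rintro x ⟨f, hf, -⟩
  refine (hf.1 ?_).elim
  haveI : IsIso f.hom.hom := inferInstance
  exact (ObjectProperty.isIso_hom_iff f.hom).mp inferInstance

/-- Every object of the one-morphism base is an RC-subanchor (it maps — identically — to an RC-anchor).
[cite: MochizukiFrdII2008, Def 3.1 (v) p.25] -/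
theorem isRCSubanchor_discretePUnit (X : Discrete PUnit.{1}) : RC.IsRCSubanchor (baseRC ptBase) X :=
  ⟨X, isRCAnchor_discretePUnit X, ⟨𝟙 X⟩⟩

/-- Every object of the one-morphism base is an RC-iso-subanchor: the identity is a mono-minimal categorical
quotient of the RC-subanchor `X` by the trivial group ([FrdI] §0, «an isomorphism is always a mono-minimal
categorical quotient of its domain by the trivial group», `IsTotallyEpimorphic.isMonoMinimalQuotient_bot_of_isIso`).
[cite: MochizukiFrdII2008, Def 3.1 (v) p.25] -/
theorem isRCIsoSubanchor_discretePUnit (X : Discrete PUnit.{1}) : RC.IsRCIsoSubanchor (baseRC ptBase) X :=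
  ⟨X, ⊥, 𝟙 X, isRCSubanchor_discretePUnit X,
    PadicFrd.isTotallyEpimorphic_discretePUnit.isMonoMinimalQuotient_bot_of_isIso (𝟙 X)⟩

/-- **The one-morphism base `Spec ℂ` is of RC-iso-subanchor type** ([FrdII] Def. 3.1 (v) (d)) — the standing
hypothesis «`D` of RC-iso-subanchor type» of Prop. 3.5 / Thm. 3.6, DISCHARGED at the base of [IUTchI] Ex. 3.4 (i).
[cite: MochizukiFrdII2008, Def 3.1 (v) p.25] -/
theorem ptBase_isOfRCIsoSubanchorType : RC.IsOfRCIsoSubanchorType (baseRC ptBase) :=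
  ⟨isRCIsoSubanchor_discretePUnit⟩

/-- The one-morphism base `Spec ℂ` has no real object. [cite: MochizukiFrdII2008, Def 3.1 (v) p.24] -/
theorem isEmpty_realPart_ptBase : IsEmpty (RC.RealPart (baseRC ptBase)) :=
  ⟨fun A => absurd ((D0.isReal_toArchBase_iff D0.complex).mp A.property) (by rintro ⟨⟩)⟩

/-- The complex part of the one-morphism base `Spec ℂ` is connected (it is the whole, one-object, category).
[cite: MochizukiFrdII2008, Def 3.1 (v) p.25] -/
theorem isConnected_complexPart_ptBase : IsConnected (RC.ComplexPart (baseRC ptBase)) := by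
  haveI : Nonempty (RC.ComplexPart (baseRC ptBase)) := ⟨⟨⟨PUnit.unit⟩, D0.isComplex_specComplex⟩⟩
  refine zigzag_isConnected fun A B => ?_
  obtain ⟨⟨⟨⟩⟩, hA⟩ := A
  obtain ⟨⟨⟨⟩⟩, hB⟩ := B
  exact Relation.ReflTransGen.refl

/-- **The one-morphism base `Spec ℂ` is RC-connected** ([FrdII] Def. 3.1 (v) (a)): connected, `D[ℝ] = ∅`,
`D[ℂ] = D` connected. [cite: MochizukiFrdII2008, Def 3.1 (v) p.25] -/
theorem ptBase_isRCConnected : RC.IsRCConnected (baseRC ptBase) where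
  isConnected := isGraphConnected_iff_isConnected.mp pt_isGraphConnected
  real := Or.inl isEmpty_realPart_ptBase
  complex := Or.inr isConnected_complexPart_ptBase

/-- The one-morphism category is of FSMFF-type ([FrdI] §0: it is of FSM-type, abc-iut-L1-t4's
`PadicFrd.isOfFSMType_discretePUnit`, «thus … of FSMFF-type»). [cite: MochizukiFrdI2008, §0 p.18] -/
theorem isOfFSMFFType_discretePUnit : IsOfFSMFFType (Discrete PUnit.{1}) :=
  PadicFrd.isOfFSMType_discretePUnit.isOfFSMFFType

/-- **The one-morphism base `Spec ℂ` of [IUTchI] Ex. 3.4 (i) is of RC-standard type** ([FrdII] Def. 3.1 (v):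
totally epimorphic; (a) RC-connected; (b) complexifiable; (c) of FSMFF-type; (d) of RC-iso-subanchor type) — the
standing hypothesis on the base of [FrdII] Thm. 3.6, DISCHARGED at the IUT archimedean (complex) place.
[cite: MochizukiFrdII2008, Def 3.1 (v) p.25] -/
theorem ptBase_isOfRCStandardType : RC.IsOfRCStandardType (baseRC ptBase) where
  totallyEpimorphic := PadicFrd.isTotallyEpimorphic_discretePUnit
  rcConnected := ptBase_isRCConnected
  complexifiable := Thm36Sub.ptBase_isComplexifiable
  fsmff := isOfFSMFFType_discretePUnit
  rcIsoSubanchor := ptBase_isOfRCIsoSubanchorType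

/-! ### Proposition 3.5 (ii), (iii) [for `R`], (iv) at `C_v`, `A_v`, `R_v` — no hypothesis -/

/-- **Prop. 3.5 (ii) for `C_v`** (typed instance `Prop35ii_C`) at the base of [IUTchI] Ex. 3.4 (i): holds outright
(abc-iut-w4-d092's `prop35ii_C`; the base is totally epimorphic). [cite: MochizukiFrdII2008, Prop 3.5 (ii) p.34] -/
theorem prop35ii_C_ptBase : Literature.AlgebraicGeometry.Frobenioids.ArchFrd.Prop35ii_C ptBase :=
  prop35ii_C ptBase PadicFrd.isTotallyEpimorphic_discretePUnit

/-- **Prop. 3.5 (ii) for `A_v`** (typed instance `Prop35ii_A`) at the base of [IUTchI] Ex. 3.4 (i): holds outright.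
[cite: MochizukiFrdII2008, Prop 3.5 (ii) p.34] -/
theorem prop35ii_A_ptBase : Literature.AlgebraicGeometry.Frobenioids.ArchFrd.Prop35ii_A ptBase :=
  prop35ii_A ptBase PadicFrd.isTotallyEpimorphic_discretePUnit

/-- **`C_v` is quasi-isotropic**, unconditionally: an object of `C_v` is non-isotropic iff it is an iso-subanchor
([FrdII] Prop. 3.5 (ii) with its antecedent discharged by `ptBase_isOfRCIsoSubanchorType`).
[cite: MochizukiFrdII2008, Prop 3.5 (ii) p.34] -/
theorem Cpt.not_isIsotropic_iff_isIsoSubanchor (X : Cpt) :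
    ¬ PreFrobenioid.IsIsotropic (C.toElem ptBase) X ↔ IsIsoSubanchor X :=
  prop35ii_C_ptBase ptBase_isOfRCIsoSubanchorType X

/-- **`A_v` is quasi-isotropic**, unconditionally. [cite: MochizukiFrdII2008, Prop 3.5 (ii) p.34] -/
theorem Apt.not_isIsotropic_iff_isIsoSubanchor (X : A ptBase) :
    ¬ PreFrobenioid.IsIsotropic (A.toElem ptBase) X ↔ IsIsoSubanchor X :=
  prop35ii_A_ptBase ptBase_isOfRCIsoSubanchorType X

/-- **`R_v` is of RC-iso-subanchor type** (w.r.t. `R → C → D → D₀`), unconditionally ([FrdII] Prop. 3.5 (iii)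
for `R`, gen 2's `prop35iii_R_holds`, with its antecedent discharged). [cite: MochizukiFrdII2008, Prop 3.5 (iii) p.34] -/
theorem R.isOfRCIsoSubanchorType_ptBase :
    RC.IsOfRCIsoSubanchorType (R.toC ptBase ⋙ PreFrobenioid.baseFunctor (C.toElem ptBase) ⋙ baseRC ptBase) :=
  prop35iii_R_holds ptBase ptBase_isOfRCIsoSubanchorType

/-- **`A_v` is a Frobenioid** ([FrdII] Ex. 3.3 (iii) for the one-morphism base, by name from
`Ex33iii_isFrobenioid_holds`). [cite: MochizukiFrdII2008, Ex 3.3 (iii) p.29] -/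
theorem Apt.isFrobenioid : PreFrobenioid.IsFrobenioid (A.toElem ptBase) :=
  Ex33iii_isFrobenioid_holds ptBase pt_isGraphConnected PadicFrd.isTotallyEpimorphic_discretePUnit

/-- **Prop. 3.5 (iv) for `C_v`** (instance `Prop35iv_C`) at the base of [IUTchI] Ex. 3.4 (i): holds outright
(`C_v` is a Frobenioid, `Cpt.isFrobenioid`; the base is nonempty). [cite: MochizukiFrdII2008, Prop 3.5 (iv) p.34] -/
theorem prop35iv_C_ptBase : Literature.AlgebraicGeometry.Frobenioids.ArchFrd.Prop35iv_C ptBase :=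
  haveI : Nonempty (Discrete PUnit.{1}) := ⟨⟨PUnit.unit⟩⟩
  prop35iv_C_of_isFrobenioid ptBase Cpt.isFrobenioid

/-- **Prop. 3.5 (iv) for `A_v`** (instance `Prop35iv_A`) at the base of [IUTchI] Ex. 3.4 (i): holds outright.
[cite: MochizukiFrdII2008, Prop 3.5 (iv) p.34] -/
theorem prop35iv_A_ptBase : Literature.AlgebraicGeometry.Frobenioids.ArchFrd.Prop35iv_A ptBase :=
  haveI : Nonempty (Discrete PUnit.{1}) := ⟨⟨PUnit.unit⟩⟩
  prop35iv_A_of_isFrobenioid ptBase Apt.isFrobenioid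

/-- **`C_v` is NOT of RC-iso-subanchor type** (w.r.t. `C → D → D₀`), unconditionally.
[cite: MochizukiFrdII2008, Prop 3.5 (iv) p.34] -/
theorem Cpt.not_isOfRCIsoSubanchorType :
    ¬ RC.IsOfRCIsoSubanchorType (PreFrobenioid.baseFunctor (C.toElem ptBase) ⋙ baseRC ptBase) :=
  prop35iv_C_ptBase ptBase_isOfRCIsoSubanchorType

/-- **`A_v` is NOT of RC-iso-subanchor type** (w.r.t. `A → D → D₀`), unconditionally.
[cite: MochizukiFrdII2008, Prop 3.5 (iv) p.34] -/
theorem Apt.not_isOfRCIsoSubanchorType :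
    ¬ RC.IsOfRCIsoSubanchorType (PreFrobenioid.baseFunctor (A.toElem ptBase) ⋙ baseRC ptBase) :=
  prop35iv_A_ptBase ptBase_isOfRCIsoSubanchorType

/-! ### Theorem 3.6 (i), (ii): «standard type» at `C_v`, `A_v` — no hypothesis -/

/-- **Thm. 3.6 (i), the «standard type» conjunct, for `C_v = C_v^ℤ`**, unconditionally (abc-iut-w4-d092's
`C.isOfStandardType` with all four base hypotheses discharged at the one-morphism base).
[cite: MochizukiFrdII2008, Thm 3.6 (i) p.36] -/
theorem Cpt.isOfStandardType : (PreFrobenioidData.ofFunctor (Φ ptBase) (C.toElem ptBase)).IsOfStandardType :=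
  C.isOfStandardType ptBase pt_isGraphConnected PadicFrd.isTotallyEpimorphic_discretePUnit
    isOfFSMFFType_discretePUnit ptBase_isOfRCIsoSubanchorType

/-- **Thm. 3.6 (ii), «`A` is of standard type», for `A_v`**, unconditionally (abc-iut-w4-d092's
`A.isOfStandardType`, base hypotheses discharged). [cite: MochizukiFrdII2008, Thm 3.6 (ii) p.37] -/
theorem Apt.isOfStandardType :
    (PreFrobenioidData.ofFunctor (zeroMonoid (Discrete PUnit.{1}) : (Discrete PUnit.{1})ᵒᵖ ⥤ CommMonCat.{0})
      (A.toElem ptBase)).IsOfStandardType :=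
  A.isOfStandardType ptBase pt_isGraphConnected PadicFrd.isTotallyEpimorphic_discretePUnit
    isOfFSMFFType_discretePUnit ptBase_isOfRCIsoSubanchorType

end ArchFrd

end

end Literature.AlgebraicGeometry.Frobenioids
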